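import Summits.BirchSwinnertonDyer.BirchSwinnertonDyer.Theorems.KolyvaginDepthDoorDepthTableRowKitNoTwistOfDatum
import Summits.BirchSwinnertonDyer.BirchSwinnertonDyer.Theorems.KolyvaginDepthDoorDepthTableRowsOfPrint2
import Summits.BirchSwinnertonDyer.BirchSwinnertonDyer.Theorems.KolyvaginDepthDoorDepthTableRowsOfPrint3
import Summits.BirchSwinnertonDyer.BirchSwinnertonDyer.Theorems.KolyvaginDepthDoorDepthTableRowsOfPrint4
import HarnessLib

/-!
# Route `KolyvaginDepthDoor` — DEPTH-TABLE rows `563a1` `(5, -8, 199)`, `571b1` `(5, -8, 29)`, `643a1` `(5, -8, 149)`, `655a1` `(7, -51, 83)`, `681c1` `(5, -83, 19)`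
# without structure theorem, twist point OR SYSTEM — the bit at ANY datum (crux `KolyvaginDepthSupply`,
# stmt-BirchSwinnertonDyer-21765) — part 2 of 4

Helper file (`--supports stmt-BirchSwinnertonDyer-21765 --as helper`); it closes nothing and BSD is
not proved by it.

g6's rows `C<label>.depthRow_<p>_neg<D>_<ℓ>_noTwist` (files `…DepthTableRowsNoTwist*`) read the row off
the kit `depthRow_noTwist_of_print_of_intModel_certificate`, whose input includes a COMPATIBLE SYSTEM
`d : ∀ m : ℕ, KolyvaginHeegnerData Dt β ι m` with four coherence binders over all `(m, l)` — an input no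
row could discharge (no datum is known at `m = 0`). This file re-issues the same rows over the kit OF A
DATUM `depthRow_noTwist_of_datum_of_intModel_certificate` (file `…DepthTableRowKitNoTwistOfDatum`; engine:
`exists_kolyvaginHeegnerSystem_extending`, the UNCONDITIONAL compatible system through any datum, file
`…KolyvaginHeegnerSystem`): each row `C<label>.depthRow_<p>_neg<D>_<ℓ>_ofDatum` takes ANY single datum
`d : KolyvaginHeegnerData Dt β ι ℓ` and its bit `d.kolyvaginClass _ 1 ≠ 0`, the five named McCallum /
Gross leaves, and concludes `corank_{ℤ_p} Ш(E)[p^∞] = 0`, `rank_ℤ E(ℚ) = 2`, `rank_ℤ E^{(D)}(ℚ) ≤ 1`,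
`E(ℚ)[p] = 0`, `Ш(E/ℚ)[p] = 0`, `#Sel^(p)(E/ℚ) = p²`. The per-curve side conditions are the kernel
theorems already landed with the `_of_print` rows and the depth table. CONDITIONAL on the five facts and
the bit; per-curve; BSD is not proved by it.

-/

set_option linter.dupNamespace false

noncomputable section

open scoped Classical NumberField

namespace Summit.BirchSwinnertonDyer.BirchSwinnertonDyer.Theorems.KolyvaginDepthDoor

open Literature.NumberTheory.EllipticCurves Literature.NumberTheory.EllipticCurves.ModularForms
  Literature.NumberTheory.EllipticCurves.McCallum1991 WeierstrassCurve
open Summit.BirchSwinnertonDyer.BirchSwinnertonDyer.Rank2Observatory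
open Summit.BirchSwinnertonDyer.BirchSwinnertonDyer.Rank1Residual

namespace C563a1

/-- **DEPTH-TABLE ROW `563a1`, `(p, d_K, ℓ) = (5, -8, 199)`, without Kolyvagin's structure
theorem, WITHOUT A POINT ON THE TWIST, and WITHOUT A SYSTEM (bit at ANY datum).** For `E = 563a1`, ANY imaginary quadratic `K` with
`d_K = -8`, any frame `(Dt, β, ι)` and ANY single Kolyvagin–Heegner datum `d` at the row's Kolyvagin prime
(NO system, NO coherence binders), granted the five named leaves (Gross Prop. 5.4 (2); McCallum Lemma 4.3,
Prop. 4.4, Lemma 5.3, Prop. 2.2): IF the first derived class at the Kolyvagin prime `199` does not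
vanish, `d.kolyvaginClass _ 1 ≠ 0` (`d` of conductor `199`) (the row's bit), THEN `corank_{ℤ_5} Ш(E)[5^∞] = 0`,
`rank_ℤ E(ℚ) = 2`, `rank_ℤ E^{(-8)}(ℚ) ≤ 1`, `E(ℚ)[5] = 0`, `Ш(E/ℚ)[5] = 0` and `#Sel^(5)(E/ℚ) = 5²`
— the twin of `C563a1.depthRow_5_neg8_199_noTwist` with its SYSTEM binders (`d : ∀ m`, `hσ`, `hS₁`, `hS₂`, `hemb`) DELETED
(kit `depthRow_noTwist_of_datum_of_intModel_certificate`: the datum is extended to a compatible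
system by `exists_kolyvaginHeegnerSystem_extending`, then Kolyvagin's eigen-bound is read over `ℚ`). Every side condition is a kernel theorem of the tree. CONDITIONAL on the
five facts and the bit; per-curve; BSD is not proved by it. [cite: Kolyvagin1991MathAnn, Thm. 2.3]
[cite: McCallumLMS1991, §§2–5] [cite: GrossLMS1991, §5 (5.1)]
[cite: JetchevLauterStein2009, §3.6 (arXiv:0707.0032)] -/
theorem depthRow_5_neg8_199_ofDatum
    (h54 : sign_conjAct_kolyvaginClass) (h43 : lemma43_kolyvaginClass_mem_selmerLocalKer)
    (h44 : prop44_localOrder_kolyvaginClass_mul_eq) (h53 : lemma53_selmer_eigen_dependent_at)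
    (h22 : prop22_reciprocity_eigen_finset)
    (K : Type) [Field K] [NumberField K] (hK : IsImaginaryQuadratic K)
    (hD : NumberField.discr K = -8) :
    haveI := isElliptic_c563a1;
    haveI := isGloballyMinimal_c563a1;
    haveI : NeZero (((⟨1, 1, 1, -15, 16⟩ : WeierstrassCurve ℤ).map (Int.castRingHom ℚ)).conductorNorm ℤ) :=
      neZero_conductorNorm_of_isElliptic _;
    ∀ (Dt : ModularParametrizationData ((⟨1, 1, 1, -15, 16⟩ : WeierstrassCurve ℤ).map (Int.castRingHom ℚ))
        (((⟨1, 1, 1, -15, 16⟩ : WeierstrassCurve ℤ).map (Int.castRingHom ℚ)).conductorNorm ℤ)) (β : ℤ)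
      (ι : K →+* ℂ) (d : KolyvaginHeegnerData Dt β ι 199),
    d.kolyvaginClass (p := 5) (by norm_num) 1 ≠ 0 →
    ((⟨1, 1, 1, -15, 16⟩ : WeierstrassCurve ℤ).map (Int.castRingHom ℚ)).shaCorank 5 = 0 ∧
      ((⟨1, 1, 1, -15, 16⟩ : WeierstrassCurve ℤ).map (Int.castRingHom ℚ)).mordellWeilRank = 2 ∧
      (((⟨1, 1, 1, -15, 16⟩ : WeierstrassCurve ℤ).map (Int.castRingHom ℚ)).quadraticTwist
        ((-8 : ℤ) : ℚ)).mordellWeilRank ≤ 1 ∧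
      (∀ P : ((⟨1, 1, 1, -15, 16⟩ : WeierstrassCurve ℤ).map (Int.castRingHom ℚ)).toAffine.Point,
        5 • P = 0 → P = 0) ∧
      (∀ x ∈ ((⟨1, 1, 1, -15, 16⟩ : WeierstrassCurve ℤ).map (Int.castRingHom ℚ)).sha, 5 • x = 0 → x = 0) ∧
      Nat.card ↥(selmerGroup ((⟨1, 1, 1, -15, 16⟩ : WeierstrassCurve ℤ).map (Int.castRingHom ℚ))
        ((5 : ℕ) : ℤ)) = 5 ^ 2 := by
  haveI := isElliptic_c563a1
  haveI := isGloballyMinimal_c563a1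
  haveI : NeZero (((⟨1, 1, 1, -15, 16⟩ : WeierstrassCurve ℤ).map (Int.castRingHom ℚ)).conductorNorm ℤ) :=
    neZero_conductorNorm_of_isElliptic _
  intro Dt β ι d hne
  haveI := Fact.mk (by norm_num : Nat.Prime 5)
  exact depthRow_noTwist_of_datum_of_intModel_certificate intModel h54 h43 h44 h53 h22 not_hasCM
    KernelCerts001.C563a1.two_le_rank 5 (by norm_num) hasSurjectiveModNGaloisRep_pow_5 K hK hD
    (by norm_num) (by norm_num) heegner_neg8 199 (by norm_num) (by norm_num) (by decide +kernel)
    (by norm_num) (by norm_num) (by norm_num) (by norm_num) (n := 220) card_199 (by norm_num) Dt β ι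
    d hne

end C563a1

namespace C571b1

/-- **DEPTH-TABLE ROW `571b1`, `(p, d_K, ℓ) = (5, -8, 29)`, without Kolyvagin's structure
theorem, WITHOUT A POINT ON THE TWIST, and WITHOUT A SYSTEM (bit at ANY datum).** For `E = 571b1`, ANY imaginary quadratic `K` with
`d_K = -8`, any frame `(Dt, β, ι)` and ANY single Kolyvagin–Heegner datum `d` at the row's Kolyvagin prime
(NO system, NO coherence binders), granted the five named leaves (Gross Prop. 5.4 (2); McCallum Lemma 4.3,
Prop. 4.4, Lemma 5.3, Prop. 2.2): IF the first derived class at the Kolyvagin prime `29` does not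
vanish, `d.kolyvaginClass _ 1 ≠ 0` (`d` of conductor `29`) (the row's bit), THEN `corank_{ℤ_5} Ш(E)[5^∞] = 0`,
`rank_ℤ E(ℚ) = 2`, `rank_ℤ E^{(-8)}(ℚ) ≤ 1`, `E(ℚ)[5] = 0`, `Ш(E/ℚ)[5] = 0` and `#Sel^(5)(E/ℚ) = 5²`
— the twin of `C571b1.depthRow_5_neg8_29_noTwist` with its SYSTEM binders (`d : ∀ m`, `hσ`, `hS₁`, `hS₂`, `hemb`) DELETED
(kit `depthRow_noTwist_of_datum_of_intModel_certificate`: the datum is extended to a compatible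
system by `exists_kolyvaginHeegnerSystem_extending`, then Kolyvagin's eigen-bound is read over `ℚ`). Every side condition is a kernel theorem of the tree. CONDITIONAL on the
five facts and the bit; per-curve; BSD is not proved by it. [cite: Kolyvagin1991MathAnn, Thm. 2.3]
[cite: McCallumLMS1991, §§2–5] [cite: GrossLMS1991, §5 (5.1)]
[cite: JetchevLauterStein2009, §3.6 (arXiv:0707.0032)] -/
theorem depthRow_5_neg8_29_ofDatum
    (h54 : sign_conjAct_kolyvaginClass) (h43 : lemma43_kolyvaginClass_mem_selmerLocalKer)
    (h44 : prop44_localOrder_kolyvaginClass_mul_eq) (h53 : lemma53_selmer_eigen_dependent_at)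
    (h22 : prop22_reciprocity_eigen_finset)
    (K : Type) [Field K] [NumberField K] (hK : IsImaginaryQuadratic K)
    (hD : NumberField.discr K = -8) :
    haveI := isElliptic_c571b1;
    haveI := isGloballyMinimal_c571b1;
    haveI : NeZero (((⟨0, 1, 1, -4, 2⟩ : WeierstrassCurve ℤ).map (Int.castRingHom ℚ)).conductorNorm ℤ) :=
      neZero_conductorNorm_of_isElliptic _;
    ∀ (Dt : ModularParametrizationData ((⟨0, 1, 1, -4, 2⟩ : WeierstrassCurve ℤ).map (Int.castRingHom ℚ))
        (((⟨0, 1, 1, -4, 2⟩ : WeierstrassCurve ℤ).map (Int.castRingHom ℚ)).conductorNorm ℤ)) (β : ℤ)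
      (ι : K →+* ℂ) (d : KolyvaginHeegnerData Dt β ι 29),
    d.kolyvaginClass (p := 5) (by norm_num) 1 ≠ 0 →
    ((⟨0, 1, 1, -4, 2⟩ : WeierstrassCurve ℤ).map (Int.castRingHom ℚ)).shaCorank 5 = 0 ∧
      ((⟨0, 1, 1, -4, 2⟩ : WeierstrassCurve ℤ).map (Int.castRingHom ℚ)).mordellWeilRank = 2 ∧
      (((⟨0, 1, 1, -4, 2⟩ : WeierstrassCurve ℤ).map (Int.castRingHom ℚ)).quadraticTwist
        ((-8 : ℤ) : ℚ)).mordellWeilRank ≤ 1 ∧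
      (∀ P : ((⟨0, 1, 1, -4, 2⟩ : WeierstrassCurve ℤ).map (Int.castRingHom ℚ)).toAffine.Point,
        5 • P = 0 → P = 0) ∧
      (∀ x ∈ ((⟨0, 1, 1, -4, 2⟩ : WeierstrassCurve ℤ).map (Int.castRingHom ℚ)).sha, 5 • x = 0 → x = 0) ∧
      Nat.card ↥(selmerGroup ((⟨0, 1, 1, -4, 2⟩ : WeierstrassCurve ℤ).map (Int.castRingHom ℚ))
        ((5 : ℕ) : ℤ)) = 5 ^ 2 := by
  haveI := isElliptic_c571b1
  haveI := isGloballyMinimal_c571b1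
  haveI : NeZero (((⟨0, 1, 1, -4, 2⟩ : WeierstrassCurve ℤ).map (Int.castRingHom ℚ)).conductorNorm ℤ) :=
    neZero_conductorNorm_of_isElliptic _
  intro Dt β ι d hne
  haveI := Fact.mk (by norm_num : Nat.Prime 5)
  exact depthRow_noTwist_of_datum_of_intModel_certificate intModel h54 h43 h44 h53 h22 not_hasCM
    KernelCerts001.C571b1.two_le_rank 5 (by norm_num) hasSurjectiveModNGaloisRep_pow_5 K hK hD
    (by norm_num) (by norm_num) heegner_neg8 29 (by norm_num) (by norm_num) (by decide +kernel)
    (by norm_num) (by norm_num) (by norm_num) (by norm_num) (n := 25) card_29 (by norm_num) Dt β ι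
    d hne

end C571b1

namespace C643a1

/-- **DEPTH-TABLE ROW `643a1`, `(p, d_K, ℓ) = (5, -8, 149)`, without Kolyvagin's structure
theorem, WITHOUT A POINT ON THE TWIST, and WITHOUT A SYSTEM (bit at ANY datum).** For `E = 643a1`, ANY imaginary quadratic `K` with
`d_K = -8`, any frame `(Dt, β, ι)` and ANY single Kolyvagin–Heegner datum `d` at the row's Kolyvagin prime
(NO system, NO coherence binders), granted the five named leaves (Gross Prop. 5.4 (2); McCallum Lemma 4.3,
Prop. 4.4, Lemma 5.3, Prop. 2.2): IF the first derived class at the Kolyvagin prime `149` does not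
vanish, `d.kolyvaginClass _ 1 ≠ 0` (`d` of conductor `149`) (the row's bit), THEN `corank_{ℤ_5} Ш(E)[5^∞] = 0`,
`rank_ℤ E(ℚ) = 2`, `rank_ℤ E^{(-8)}(ℚ) ≤ 1`, `E(ℚ)[5] = 0`, `Ш(E/ℚ)[5] = 0` and `#Sel^(5)(E/ℚ) = 5²`
— the twin of `C643a1.depthRow_5_neg8_149_noTwist` with its SYSTEM binders (`d : ∀ m`, `hσ`, `hS₁`, `hS₂`, `hemb`) DELETED
(kit `depthRow_noTwist_of_datum_of_intModel_certificate`: the datum is extended to a compatible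
system by `exists_kolyvaginHeegnerSystem_extending`, then Kolyvagin's eigen-bound is read over `ℚ`). Every side condition is a kernel theorem of the tree. CONDITIONAL on the
five facts and the bit; per-curve; BSD is not proved by it. [cite: Kolyvagin1991MathAnn, Thm. 2.3]
[cite: McCallumLMS1991, §§2–5] [cite: GrossLMS1991, §5 (5.1)]
[cite: JetchevLauterStein2009, §3.6 (arXiv:0707.0032)] -/
theorem depthRow_5_neg8_149_ofDatum
    (h54 : sign_conjAct_kolyvaginClass) (h43 : lemma43_kolyvaginClass_mem_selmerLocalKer)
    (h44 : prop44_localOrder_kolyvaginClass_mul_eq) (h53 : lemma53_selmer_eigen_dependent_at)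
    (h22 : prop22_reciprocity_eigen_finset)
    (K : Type) [Field K] [NumberField K] (hK : IsImaginaryQuadratic K)
    (hD : NumberField.discr K = -8) :
    haveI := isElliptic_c643a1;
    haveI := isGloballyMinimal_c643a1;
    haveI : NeZero (((⟨1, 0, 0, -4, 3⟩ : WeierstrassCurve ℤ).map (Int.castRingHom ℚ)).conductorNorm ℤ) :=
      neZero_conductorNorm_of_isElliptic _;
    ∀ (Dt : ModularParametrizationData ((⟨1, 0, 0, -4, 3⟩ : WeierstrassCurve ℤ).map (Int.castRingHom ℚ))
        (((⟨1, 0, 0, -4, 3⟩ : WeierstrassCurve ℤ).map (Int.castRingHom ℚ)).conductorNorm ℤ)) (β : ℤ)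
      (ι : K →+* ℂ) (d : KolyvaginHeegnerData Dt β ι 149),
    d.kolyvaginClass (p := 5) (by norm_num) 1 ≠ 0 →
    ((⟨1, 0, 0, -4, 3⟩ : WeierstrassCurve ℤ).map (Int.castRingHom ℚ)).shaCorank 5 = 0 ∧
      ((⟨1, 0, 0, -4, 3⟩ : WeierstrassCurve ℤ).map (Int.castRingHom ℚ)).mordellWeilRank = 2 ∧
      (((⟨1, 0, 0, -4, 3⟩ : WeierstrassCurve ℤ).map (Int.castRingHom ℚ)).quadraticTwist
        ((-8 : ℤ) : ℚ)).mordellWeilRank ≤ 1 ∧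
      (∀ P : ((⟨1, 0, 0, -4, 3⟩ : WeierstrassCurve ℤ).map (Int.castRingHom ℚ)).toAffine.Point,
        5 • P = 0 → P = 0) ∧
      (∀ x ∈ ((⟨1, 0, 0, -4, 3⟩ : WeierstrassCurve ℤ).map (Int.castRingHom ℚ)).sha, 5 • x = 0 → x = 0) ∧
      Nat.card ↥(selmerGroup ((⟨1, 0, 0, -4, 3⟩ : WeierstrassCurve ℤ).map (Int.castRingHom ℚ))
        ((5 : ℕ) : ℤ)) = 5 ^ 2 := by
  haveI := isElliptic_c643a1
  haveI := isGloballyMinimal_c643a1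
  haveI : NeZero (((⟨1, 0, 0, -4, 3⟩ : WeierstrassCurve ℤ).map (Int.castRingHom ℚ)).conductorNorm ℤ) :=
    neZero_conductorNorm_of_isElliptic _
  intro Dt β ι d hne
  haveI := Fact.mk (by norm_num : Nat.Prime 5)
  exact depthRow_noTwist_of_datum_of_intModel_certificate intModel h54 h43 h44 h53 h22 not_hasCM
    KernelCerts001.C643a1.two_le_rank 5 (by norm_num) hasSurjectiveModNGaloisRep_pow_5 K hK hD
    (by norm_num) (by norm_num) heegner_neg8 149 (by norm_num) (by norm_num) (by decide +kernel)
    (by norm_num) (by norm_num) (by norm_num) (by norm_num) (n := 135) card_149 (by norm_num) Dt β ι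
    d hne

end C643a1

namespace C655a1

/-- **DEPTH-TABLE ROW `655a1`, `(p, d_K, ℓ) = (7, -51, 83)`, without Kolyvagin's structure
theorem, WITHOUT A POINT ON THE TWIST, and WITHOUT A SYSTEM (bit at ANY datum).** For `E = 655a1`, ANY imaginary quadratic `K` with
`d_K = -51`, any frame `(Dt, β, ι)` and ANY single Kolyvagin–Heegner datum `d` at the row's Kolyvagin prime
(NO system, NO coherence binders), granted the five named leaves (Gross Prop. 5.4 (2); McCallum Lemma 4.3,
Prop. 4.4, Lemma 5.3, Prop. 2.2): IF the first derived class at the Kolyvagin prime `83` does not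
vanish, `d.kolyvaginClass _ 1 ≠ 0` (`d` of conductor `83`) (the row's bit), THEN `corank_{ℤ_7} Ш(E)[7^∞] = 0`,
`rank_ℤ E(ℚ) = 2`, `rank_ℤ E^{(-51)}(ℚ) ≤ 1`, `E(ℚ)[7] = 0`, `Ш(E/ℚ)[7] = 0` and `#Sel^(7)(E/ℚ) = 7²`
— the twin of `C655a1.depthRow_7_neg51_83_noTwist` with its SYSTEM binders (`d : ∀ m`, `hσ`, `hS₁`, `hS₂`, `hemb`) DELETED
(kit `depthRow_noTwist_of_datum_of_intModel_certificate`: the datum is extended to a compatible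
system by `exists_kolyvaginHeegnerSystem_extending`, then Kolyvagin's eigen-bound is read over `ℚ`). Every side condition is a kernel theorem of the tree. CONDITIONAL on the
five facts and the bit; per-curve; BSD is not proved by it. [cite: Kolyvagin1991MathAnn, Thm. 2.3]
[cite: McCallumLMS1991, §§2–5] [cite: GrossLMS1991, §5 (5.1)]
[cite: JetchevLauterStein2009, §3.6 (arXiv:0707.0032)] -/
theorem depthRow_7_neg51_83_ofDatum
    (h54 : sign_conjAct_kolyvaginClass) (h43 : lemma43_kolyvaginClass_mem_selmerLocalKer)
    (h44 : prop44_localOrder_kolyvaginClass_mul_eq) (h53 : lemma53_selmer_eigen_dependent_at)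
    (h22 : prop22_reciprocity_eigen_finset)
    (K : Type) [Field K] [NumberField K] (hK : IsImaginaryQuadratic K)
    (hD : NumberField.discr K = -51) :
    haveI := isElliptic_c655a1;
    haveI := isGloballyMinimal_c655a1;
    haveI : NeZero (((⟨0, 0, 1, -13, 18⟩ : WeierstrassCurve ℤ).map (Int.castRingHom ℚ)).conductorNorm ℤ) :=
      neZero_conductorNorm_of_isElliptic _;
    ∀ (Dt : ModularParametrizationData ((⟨0, 0, 1, -13, 18⟩ : WeierstrassCurve ℤ).map (Int.castRingHom ℚ))
        (((⟨0, 0, 1, -13, 18⟩ : WeierstrassCurve ℤ).map (Int.castRingHom ℚ)).conductorNorm ℤ)) (β : ℤ)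
      (ι : K →+* ℂ) (d : KolyvaginHeegnerData Dt β ι 83),
    d.kolyvaginClass (p := 7) (by norm_num) 1 ≠ 0 →
    ((⟨0, 0, 1, -13, 18⟩ : WeierstrassCurve ℤ).map (Int.castRingHom ℚ)).shaCorank 7 = 0 ∧
      ((⟨0, 0, 1, -13, 18⟩ : WeierstrassCurve ℤ).map (Int.castRingHom ℚ)).mordellWeilRank = 2 ∧
      (((⟨0, 0, 1, -13, 18⟩ : WeierstrassCurve ℤ).map (Int.castRingHom ℚ)).quadraticTwist
        ((-51 : ℤ) : ℚ)).mordellWeilRank ≤ 1 ∧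
      (∀ P : ((⟨0, 0, 1, -13, 18⟩ : WeierstrassCurve ℤ).map (Int.castRingHom ℚ)).toAffine.Point,
        7 • P = 0 → P = 0) ∧
      (∀ x ∈ ((⟨0, 0, 1, -13, 18⟩ : WeierstrassCurve ℤ).map (Int.castRingHom ℚ)).sha, 7 • x = 0 → x = 0) ∧
      Nat.card ↥(selmerGroup ((⟨0, 0, 1, -13, 18⟩ : WeierstrassCurve ℤ).map (Int.castRingHom ℚ))
        ((7 : ℕ) : ℤ)) = 7 ^ 2 := by
  haveI := isElliptic_c655a1
  haveI := isGloballyMinimal_c655a1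
  haveI : NeZero (((⟨0, 0, 1, -13, 18⟩ : WeierstrassCurve ℤ).map (Int.castRingHom ℚ)).conductorNorm ℤ) :=
    neZero_conductorNorm_of_isElliptic _
  intro Dt β ι d hne
  haveI := Fact.mk (by norm_num : Nat.Prime 7)
  exact depthRow_noTwist_of_datum_of_intModel_certificate intModel h54 h43 h44 h53 h22 not_hasCM
    KernelCerts001.C655a1.two_le_rank 7 (by norm_num) hasSurjectiveModNGaloisRep_pow_7 K hK hD
    (by norm_num) (by norm_num) heegner_neg51 83 (by norm_num) (by norm_num) (by decide +kernel)
    (by norm_num) (by norm_num) (by norm_num) (by norm_num) (n := 70) card_83 (by norm_num) Dt β ι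
    d hne

end C655a1

namespace C681c1

/-- **DEPTH-TABLE ROW `681c1`, `(p, d_K, ℓ) = (5, -83, 19)`, without Kolyvagin's structure
theorem, WITHOUT A POINT ON THE TWIST, and WITHOUT A SYSTEM (bit at ANY datum).** For `E = 681c1`, ANY imaginary quadratic `K` with
`d_K = -83`, any frame `(Dt, β, ι)` and ANY single Kolyvagin–Heegner datum `d` at the row's Kolyvagin prime
(NO system, NO coherence binders), granted the five named leaves (Gross Prop. 5.4 (2); McCallum Lemma 4.3,
Prop. 4.4, Lemma 5.3, Prop. 2.2): IF the first derived class at the Kolyvagin prime `19` does not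
vanish, `d.kolyvaginClass _ 1 ≠ 0` (`d` of conductor `19`) (the row's bit), THEN `corank_{ℤ_5} Ш(E)[5^∞] = 0`,
`rank_ℤ E(ℚ) = 2`, `rank_ℤ E^{(-83)}(ℚ) ≤ 1`, `E(ℚ)[5] = 0`, `Ш(E/ℚ)[5] = 0` and `#Sel^(5)(E/ℚ) = 5²`
— the twin of `C681c1.depthRow_5_neg83_19_noTwist` with its SYSTEM binders (`d : ∀ m`, `hσ`, `hS₁`, `hS₂`, `hemb`) DELETED
(kit `depthRow_noTwist_of_datum_of_intModel_certificate`: the datum is extended to a compatible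
system by `exists_kolyvaginHeegnerSystem_extending`, then Kolyvagin's eigen-bound is read over `ℚ`). Every side condition is a kernel theorem of the tree. CONDITIONAL on the
five facts and the bit; per-curve; BSD is not proved by it. [cite: Kolyvagin1991MathAnn, Thm. 2.3]
[cite: McCallumLMS1991, §§2–5] [cite: GrossLMS1991, §5 (5.1)]
[cite: JetchevLauterStein2009, §3.6 (arXiv:0707.0032)] -/
theorem depthRow_5_neg83_19_ofDatum
    (h54 : sign_conjAct_kolyvaginClass) (h43 : lemma43_kolyvaginClass_mem_selmerLocalKer)
    (h44 : prop44_localOrder_kolyvaginClass_mul_eq) (h53 : lemma53_selmer_eigen_dependent_at)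
    (h22 : prop22_reciprocity_eigen_finset)
    (K : Type) [Field K] [NumberField K] (hK : IsImaginaryQuadratic K)
    (hD : NumberField.discr K = -83) :
    haveI := isElliptic_c681c1;
    haveI := isGloballyMinimal_c681c1;
    haveI : NeZero (((⟨0, -1, 1, 0, 2⟩ : WeierstrassCurve ℤ).map (Int.castRingHom ℚ)).conductorNorm ℤ) :=
      neZero_conductorNorm_of_isElliptic _;
    ∀ (Dt : ModularParametrizationData ((⟨0, -1, 1, 0, 2⟩ : WeierstrassCurve ℤ).map (Int.castRingHom ℚ))
        (((⟨0, -1, 1, 0, 2⟩ : WeierstrassCurve ℤ).map (Int.castRingHom ℚ)).conductorNorm ℤ)) (β : ℤ)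
      (ι : K →+* ℂ) (d : KolyvaginHeegnerData Dt β ι 19),
    d.kolyvaginClass (p := 5) (by norm_num) 1 ≠ 0 →
    ((⟨0, -1, 1, 0, 2⟩ : WeierstrassCurve ℤ).map (Int.castRingHom ℚ)).shaCorank 5 = 0 ∧
      ((⟨0, -1, 1, 0, 2⟩ : WeierstrassCurve ℤ).map (Int.castRingHom ℚ)).mordellWeilRank = 2 ∧
      (((⟨0, -1, 1, 0, 2⟩ : WeierstrassCurve ℤ).map (Int.castRingHom ℚ)).quadraticTwist
        ((-83 : ℤ) : ℚ)).mordellWeilRank ≤ 1 ∧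
      (∀ P : ((⟨0, -1, 1, 0, 2⟩ : WeierstrassCurve ℤ).map (Int.castRingHom ℚ)).toAffine.Point,
        5 • P = 0 → P = 0) ∧
      (∀ x ∈ ((⟨0, -1, 1, 0, 2⟩ : WeierstrassCurve ℤ).map (Int.castRingHom ℚ)).sha, 5 • x = 0 → x = 0) ∧
      Nat.card ↥(selmerGroup ((⟨0, -1, 1, 0, 2⟩ : WeierstrassCurve ℤ).map (Int.castRingHom ℚ))
        ((5 : ℕ) : ℤ)) = 5 ^ 2 := by
  haveI := isElliptic_c681c1
  haveI := isGloballyMinimal_c681c1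
  haveI : NeZero (((⟨0, -1, 1, 0, 2⟩ : WeierstrassCurve ℤ).map (Int.castRingHom ℚ)).conductorNorm ℤ) :=
    neZero_conductorNorm_of_isElliptic _
  intro Dt β ι d hne
  haveI := Fact.mk (by norm_num : Nat.Prime 5)
  exact depthRow_noTwist_of_datum_of_intModel_certificate intModel h54 h43 h44 h53 h22 not_hasCM
    KernelCerts002.C681c1.two_le_rank 5 (by norm_num) hasSurjectiveModNGaloisRep_pow_5 K hK hD
    (by norm_num) (by norm_num) heegner_neg83 19 (by norm_num) (by norm_num) (by decide +kernel)
    (by norm_num) (by norm_num) (by norm_num) (by norm_num) (n := 25) card_19 (by norm_num) Dt β ι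
    d hne

end C681c1

end Summit.BirchSwinnertonDyer.BirchSwinnertonDyer.Theorems.KolyvaginDepthDoor

end
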